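import Literature.Geometry.Kaehler.SiegelTorusThetaDivisorCroftonJensen
import Literature.Geometry.Kaehler.HolomorphicChainPoincareLelongHypersurface
import Literature.Geometry.Kaehler.ComplexTorusAnalyticHypersurfaceTheta
import Literature.Geometry.Kaehler.ComplexTorusAppellHumbertUniqueness
import Literature.Geometry.Kaehler.ComplexTorusPolarizationType
import HarnessLib

/-!
# The Poincaré–Lelong formula on a complex torus: `[Y] = c₁(𝒪_X(Y))` for every analytic hypersurface

Layer `Literature/Geometry/Kaehler`, namespace `Literature.Geometry.Kaehler.ComplexTorus`; lane
`lit-hodgefound` (Track 2 foundations library), skeleton seat `lit-hodgefound-skel-2` (generation 33),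
FILE 3 of the programme «the Poincaré–Lelong formula for a reduced analytic hypersurface, and
`[Y] = c₁(𝒪_X(Y))` on a complex torus» (SKELETON row A2-113). JUNCTION of Layer A2 (line bundles,
theta functions: `ComplexTorusAnalyticHypersurfaceTheta.exists_thetaFunction_of_hasPureCodim_one` —
every analytic hypersurface `Y ⊂ X = E/Λ` is `{ϑ = 0}` for a classical theta function `ϑ` of type
`(H, χ)` with `𝒪_X(Y) ≅ L(H, χ)` which is a MINIMAL defining function of `π⁻¹Y`) with Layer A4
(the analytic cycle class `[Y]_e ∈ H²(X, ℂ) = Alt²_ℝ(E; ℂ)` of `ComplexTorusAnalyticCycleClass`),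
through the Poincaré–Lelong formula in Crofton–Jensen form (FILE 2,
`HolomorphicChain.two_pi_mul_setIntegral_carrier_eq_of_exists_ne_zero`) and the torus glue of p07's
`SiegelTorusThetaDivisorCroftonJensen` §1–§3 (weighted periods, the normalisation
`vol(b) · covol = 1`), consumed BY NAME.

Sources followed: P. Griffiths, J. Harris, *Principles of Algebraic Geometry* (1978), Ch. 1 §1,
p. 141: "the first Chern class of the line bundle `[D]` is the fundamental class of `D`"
(`c₁([D]) = η_D`, the Poincaré dual of the current of integration over `D`; proof via the
Poincaré–Lelong equation, Ch. 3 §2 pp. 388–390) and E. M. Chirka, *Complex Analytic Sets* (1989),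
§16.3 Thm. 1 (`D_f = (i/π)∂∂̄ log|f|`; proof p. 216 in the coordinates `z = (z', z_n)`), read on the
complex torus with H. Lange, *Abelian Varieties over the Complex Numbers* (2023), §1.3.1 (1.11)
(the canonical factor `a_{(H,χ)}(λ, v) = χ(λ) e(π H(v, λ) + (π/2) H(λ, λ))`), Lemma 1.3.1 (ii) /
§2.1.1 p. 76 ("the first Chern class `H = c₁(L)`"), §1.6.1 (1.24) (the metric `e^{-π H(v,v)}` making
`|ϑ|² e^{-πH}` periodic) — the tree's normalisation `c₁(L(H, χ)) = ofRealForm (-E)`, `E = Im H`,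
`H(v, v) = E(iv, v)` (`ComplexTorusAppellHumbertChernClass`, `hermOf`).

## Contents (theorems only; no definition, no named fact, net debt `0`)

* §1 `log_norm_sub_ahExponent_periodic` — for `ϑ ∈ thetaFunctions(a_{(H,χ)})`,
  `log ‖ϑ‖ - (π/2) E(i·, ·)` is `Λ`-periodic off `{ϑ = 0}` (`|a_{(H,χ)}(λ, v)| = exp(π Re H(v, λ) +
  (π/2) H(λ, λ))`, `norm_canonicalFactor`).
* §2 `exists_bilin_apply_I_smul`, `lineLaplacian_ahExponent` (`Δ_v E(i·, ·) ≡ 4 E(iv, v)`),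
  **`integral_log_norm_theta_mul_lineLaplacian_weight`**: for a unit vector `v` and the fundamental
  weight `w` of `Λ`, `∫ log ‖ϑ‖ · Δ_v w d𝓗^{dim_ℝ E} = 2π · E(iv, v) · covol(Λ)` (riders #8–#11 of
  p07 gen 19: the periodic part pairs to `0`, the quadratic part by the symmetric pairing).
* §3 **`analyticCycleClass_apply_pair_eq_of_thetaFunction`**: for a closed analytic `Y ⊂ X` of pure
  dimension `d`, `2d + 2 = rk Λ`, a positively oriented `e`, and a theta function `ϑ ≠ 0` of type
  `(H, χ)` with `{ϑ = 0} = π⁻¹Y` which is a MINIMAL defining function of `π⁻¹Y`: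
  `[Y]_e(v, iv) = E(iv, v) = H(v, v)` for every `v` (unit `v` by FILE 2 + §2 + the normalisation;
  all `v` by homogeneity).
* §4 `twoForm_eq_of_forall_apply_I_smul_self` (two `I`-invariant real `2`-forms with the same
  `H(v, v)` coincide — polarization), **`analyticCycleClass_eq_ofRealForm_neg_of_thetaFunction`**:
  `[Y]_e = ofRealForm (-E) = c₁(L(H, χ))`, and **`analyticCycleClass_eq_chernClass_of_hasPureDim`**:
  for EVERY analytic hypersurface `Y` of `X` (singular allowed) there are `(H, χ)` and an effective
  Cartier divisor `D` with `|D| = Y`, `𝒪_X(D) ≅ L(H, χ)` and `[Y]_e = ofRealForm (-Im H)` — the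
  Poincaré–Lelong / Griffiths–Harris identity `[Y] = c₁(𝒪_X(Y))` in `H²(X)`.

## References

* [GriffithsHarrisPrinciples1978] P. Griffiths, J. Harris, *Principles of Algebraic Geometry*
  (1978), Ch. 1 §1 p. 141; Ch. 3 §2 pp. 388–390.
* [Chirka1989] E. M. Chirka, *Complex Analytic Sets*, Kluwer (1989), §16.3 Thm. 1 (pp. 214–216),
  §2.9 Prop. 2 (p. 27).
* [Lange2023AbelianVarietiesComplex] H. Lange, *Abelian Varieties over the Complex Numbers* (2023),
  §1.3.1 (1.11), Lemma 1.3.1; §1.6.1 (1.24); §2.1.1 p. 76; §6.2.4 p. 310.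
* [VoisinHodgeI2002] C. Voisin, *Hodge Theory and Complex Algebraic Geometry I* (2002), §11.1.2
  Cor. 11.15, Thm. 11.33 (`[D] = c₁(𝒪(D))`).
-/

noncomputable section

open scoped Manifold Topology ENNReal NNReal Real InnerProductSpace ComplexOrder
open Set Filter MeasureTheory Metric Function Module TopologicalSpace Complex

namespace Literature.Geometry.Kaehler

namespace ComplexTorus

open Literature.Geometry.GeometricMeasureTheory Literature.Analysis.Complex HolomorphicChain

universe u

/-! ### §1 `log ‖ϑ‖ - (π/2) H(v, v)` is `Λ`-periodic for a theta function of type `(H, χ)` -/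

section Periodic

variable {ι : Type*} [Fintype ι] {E : Type u} [NormedAddCommGroup E] [NormedSpace ℂ E]
  (Φ : (ι → ℝ) ≃L[ℝ] E) {η : E [⋀^Fin 2]→L[ℝ] ℝ} {χ : (ι → ℤ) → ℂ}

/-- For `η` of type `(1,1)`: `η(iv, w) = η(iw, v)` (`Re H` is symmetric).
[cite: Lange2023AbelianVarietiesComplex, §1.2.2 Lemma 1.2.10] -/
theorem apply_I_smul_symm_of_type_one_one (h11 : ∀ u v : E, η ![I • u, I • v] = η ![u, v])
    (v w : E) : η ![I • v, w] = η ![I • w, v] := by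
  have h := h11 w (I • v)
  rw [smul_smul, Complex.I_mul_I, neg_one_smul, twoForm_swap η (I • w) (-v),
    show η ![-v, I • w] = -η ![v, I • w] by
      rw [← neg_one_smul ℝ v, twoForm_smul_left, neg_one_mul], neg_neg] at h
  rw [twoForm_swap η (I • v) w, ← h, twoForm_swap η v (I • w), neg_neg]

/-- The exponent `q(v) = E(iv, v) = H(v, v)` under a lattice translation:
`q(v + λ) = q(v) + 2 E(iv, λ) + q(λ)` for `η` of type `(1,1)`.
[cite: Lange2023AbelianVarietiesComplex, §1.6.1 (1.24)] -/
theorem ahExponent_add (h11 : ∀ u v : E, η ![I • u, I • v] = η ![u, v]) (v w : E) :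
    η ![I • (v + w), v + w] = η ![I • v, v] + 2 * η ![I • v, w] + η ![I • w, w] := by
  rw [smul_add, twoForm_add_left, twoForm_add_right, twoForm_add_right,
    apply_I_smul_symm_of_type_one_one h11 w v]
  ring

omit [Fintype ι] in
/-- **`log ‖ϑ‖ - (π/2) H(·, ·)` is `Λ`-periodic off the zero set** of a classical theta function `ϑ`
of type `(H, χ)`: `|a_{(H,χ)}(λ, v)| = exp(π Re H(v, λ) + (π/2) H(λ, λ))` and
`H(v + λ, v + λ) = H(v, v) + 2 Re H(v, λ) + H(λ, λ)` — the pointwise norm `|ϑ|² e^{-π H(v,v)}` of the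
section `ϑ` for the metric (1.24) is periodic. [cite: Lange2023AbelianVarietiesComplex, §1.3.1 (1.11)
and §1.6.1 (1.24)] [cite: GriffithsHarrisPrinciples1978, Ch. 2 §6 (p. 310)] -/
theorem log_norm_sub_ahExponent_periodic (hη : IsNSForm Φ η) (hχ : IsSemicharacter Φ η χ)
    {ϑ : E → ℂ} (hϑ : ϑ ∈ thetaFunctions Φ (canonicalFactor Φ η χ)) (m : ι → ℤ) {x : E}
    (hx : ϑ x ≠ 0) :
    Real.log ‖ϑ (latticeVec Φ m + x)‖ -
        π / 2 * η ![I • (latticeVec Φ m + x), latticeVec Φ m + x] =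
      Real.log ‖ϑ x‖ - π / 2 * η ![I • x, x] := by
  have hfe := (mem_thetaFunctions_iff.1 hϑ).2 m x
  rw [add_comm (latticeVec Φ m) x, hfe, norm_mul,
    Real.log_mul (norm_ne_zero_iff.2 (canonicalFactor_ne_zero_of_norm_eq_one Φ η hχ.norm_eq_one m x))
      (norm_ne_zero_iff.2 hx),
    norm_canonicalFactor Φ η hχ.norm_eq_one m x, Real.log_exp, hermOf_re, hermOf_re,
    ahExponent_add hη.type_one_one x (latticeVec Φ m)]
  ring

end Periodic

/-! ### §2 The right-hand side `∫ log ‖ϑ‖ · Δ_v w = 2π H(v, v) · covol` -/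

section RightHandSide

variable {ι : Type*} [Fintype ι] [DecidableEq ι] {E : Type u} [NormedAddCommGroup E]
  [InnerProductSpace ℂ E] [FiniteDimensional ℂ E] [MeasurableSpace E] [BorelSpace E]
  (Φ : (ι → ℝ) ≃L[ℝ] E) {η : E [⋀^Fin 2]→L[ℝ] ℝ} {χ : (ι → ℤ) → ℂ}

omit [Fintype ι] [DecidableEq ι] [MeasurableSpace E] [BorelSpace E] in
/-- `(x, y) ↦ E(ix, y) = Re H(x, y)` as a continuous real bilinear map (finite dimension).
[cite: Lange2023AbelianVarietiesComplex, §1.2.2 Lemma 1.2.10] -/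
theorem exists_bilin_apply_I_smul (η : E [⋀^Fin 2]→L[ℝ] ℝ) :
    ∃ B : E →L[ℝ] E →L[ℝ] ℝ, ∀ x y, B x y = η ![I • x, y] := by
  let B₀ : E →ₗ[ℝ] E →ₗ[ℝ] ℝ := LinearMap.mk₂ ℝ (fun x y => η ![I • x, y])
    (fun x x' y => by rw [smul_add, twoForm_add_left])
    (fun c x y => by rw [smul_comm, twoForm_smul_left, smul_eq_mul])
    (fun x y y' => by rw [twoForm_add_right])
    (fun c x y => by rw [twoForm_smul_right, smul_eq_mul])
  let B : E →L[ℝ] E →L[ℝ] ℝ := LinearMap.toContinuousLinearMap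
    ((LinearMap.toContinuousLinearMap : (E →ₗ[ℝ] ℝ) ≃ₗ[ℝ] (E →L[ℝ] ℝ)).toLinearMap ∘ₗ B₀)
  exact ⟨B, fun x y => rfl⟩

omit [Fintype ι] [DecidableEq ι] [FiniteDimensional ℂ E] [MeasurableSpace E] [BorelSpace E] in
/-- **The line Laplacian of the exponent is `4 H(v, v)`**: for `q = B(·, ·)` with
`B(x, y) = E(ix, y)`: `D²q(x)[v,v] + D²q(x)[iv,iv] = 4 E(iv, v)` for all `x` (antisymmetry of `η`).
[cite: GriffithsHarrisPrinciples1978, Ch. 2 §6 (p. 310)] [cite: Lange2023AbelianVarietiesComplex, §1.6.1 (1.24)] -/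
theorem lineLaplacian_ahExponent
    {B : E →L[ℝ] E →L[ℝ] ℝ} (hB : ∀ x y, B x y = η ![I • x, y]) (x v : E) :
    fderiv ℝ (fderiv ℝ fun z => B z z) x v v +
        fderiv ℝ (fderiv ℝ fun z => B z z) x (I • v) (I • v) = 4 * η ![I • v, v] := by
  have h := lineLaplacian_bilinear_comp_linear B (ContinuousLinearMap.id ℝ E) x v
  simp only [ContinuousLinearMap.coe_id', id_eq] at h
  rw [h, hB, hB, smul_smul, Complex.I_mul_I, neg_one_smul,
    show η ![-v, I • v] = -η ![v, I • v] by rw [← neg_one_smul ℝ v, twoForm_smul_left, neg_one_mul],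
    twoForm_swap η v (I • v)]
  ring

omit [DecidableEq ι] [FiniteDimensional ℂ E] [MeasurableSpace E] [BorelSpace E] in
/-- Continuity of a second directional derivative of the fundamental weight. [cite: Federer1969, 4.1.7] -/
theorem continuous_fderiv_fderiv_weight_univ (u u' : E) :
    Continuous fun x => fderiv ℝ (fderiv ℝ (weight Φ Finset.univ)) x u u' := by
  have h2 : Continuous (fderiv ℝ (fderiv ℝ (weight Φ (Finset.univ : Finset ι)))) :=
    ((contDiff_weight Φ Finset.univ (n := 2)).fderiv_right (m := 1) le_rfl).continuous_fderiv
      one_ne_zero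
  exact (h2.clm_apply continuous_const).clm_apply continuous_const

omit [DecidableEq ι] [FiniteDimensional ℂ E] [MeasurableSpace E] [BorelSpace E] in
/-- Compact support of a second directional derivative of the fundamental weight.
[cite: Federer1969, 4.1.7] -/
theorem hasCompactSupport_fderiv_fderiv_weight_univ (u u' : E) :
    HasCompactSupport fun x => fderiv ℝ (fderiv ℝ (weight Φ Finset.univ)) x u u' :=
  ((hasCompactSupport_weight_univ Φ).fderiv ℝ).fderiv ℝ |>.comp_left
    (g := fun L : E →L[ℝ] E →L[ℝ] ℝ => L u u') rfl

/-- **`∫ log ‖ϑ‖ · Δ_v w = 2π H(v, v) · covol`.** For a classical theta function `ϑ ≢ 0` of type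
`(H, χ)` on `X = E/Λ` (`E = Im H ∈ NS(X)`, `χ` a semicharacter), a unit vector `v` and the
fundamental weight `w` of `Λ` (`Σ_λ w(· + λ) = 1`):
`∫_E log ‖ϑ(x)‖ · (D²w(x)[v,v] + D²w(x)[iv,iv]) d𝓗^{dim_ℝ E}(x) = 2π · E(iv, v) · 𝓗^{dim_ℝ E}(Φ([0,1)^ι))`.
Proof: `log ‖ϑ‖ = ρ + (π/2) q`, `ρ` `Λ`-periodic off the null set `{ϑ = 0}` (§1) so
`∫ ρ D²w[u,u] = 0` (`integral_mul_fderiv_fderiv_weight_eq_zero`), and `q = E(i·, ·)` quadratic with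
`∫ q Δ_v w = ∫ (Δ_v q) w = 4 E(iv, v) ∫ w = 4 E(iv, v) covol` (`integral_mul_lineLaplacian_eq_integral_lineLaplacian_mul`,
`integral_weight`). [cite: Chirka1989, §16.3 Thm. 1 (proof, p. 216)]
[cite: GriffithsHarrisPrinciples1978, Ch. 2 §6 (p. 310)] [cite: Lange2023AbelianVarietiesComplex, §1.6.1 (1.24)] -/
theorem integral_log_norm_theta_mul_lineLaplacian_weight (hη : IsNSForm Φ η)
    (hχ : IsSemicharacter Φ η χ) {ϑ : E → ℂ} (hϑ : ϑ ∈ thetaFunctions Φ (canonicalFactor Φ η χ))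
    (hϑ0 : ∃ z, ϑ z ≠ 0) {v : E} (hv : ‖v‖ = 1) :
    ∫ x, Real.log ‖ϑ x‖ *
        (fderiv ℝ (fderiv ℝ (weight Φ Finset.univ)) x v v +
          fderiv ℝ (fderiv ℝ (weight Φ Finset.univ)) x (I • v) (I • v))
      ∂(μHE[finrank ℝ E] : Measure E) =
      2 * π * η ![I • v, v] * (μHE[finrank ℝ E] : Measure E).real (periodBox Φ 0) := by
  letI iE : InnerProductSpace ℝ E := InnerProductSpace.complexToReal
  set μ := (μHE[finrank ℝ E] : Measure E) with hμ
  set w := weight Φ (Finset.univ : Finset ι) with hw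
  obtain ⟨B, hB⟩ := exists_bilin_apply_I_smul (E := E) η
  set ρ : E → ℝ := fun x => Real.log ‖ϑ x‖ - π / 2 * B x x with hρ
  set L : E → ℝ := fun x => fderiv ℝ (fderiv ℝ w) x v v + fderiv ℝ (fderiv ℝ w) x (I • v) (I • v)
    with hL
  have hϑd : Differentiable ℂ ϑ := (mem_thetaFunctions_iff.1 hϑ).1
  -- regularity of the weight, of its line Laplacian and of the exponent
  have hwc : ContDiff ℝ 2 w := contDiff_weight Φ Finset.univ
  have hws : HasCompactSupport w := hasCompactSupport_weight_univ Φ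
  have hLc : Continuous L := continuous_lineLaplacian hwc v
  have hLs : HasCompactSupport L := hasCompactSupport_lineLaplacian hws v
  have hqc : ContDiff ℝ 2 fun z => B z z := by
    simpa using contDiff_bilinear_comp_linear B (ContinuousLinearMap.id ℝ E) (n := 2)
  -- integrability
  have hlog : LocallyIntegrable (fun x => Real.log ‖ϑ x‖) μ :=
    locallyIntegrable_log_norm_of_isAddHaarMeasure μ hϑd hϑ0
  have hρi : LocallyIntegrable ρ μ :=
    hlog.sub ((continuous_const.mul hqc.continuous).locallyIntegrable (μ := μ))
  have hρL : Integrable (fun x => ρ x * L x) μ := by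
    simpa only [smul_eq_mul] using hρi.integrable_smul_right_of_hasCompactSupport hLc hLs
  have hqL : Integrable (fun x => B x x * L x) μ :=
    (hqc.continuous.mul hLc).integrable_of_hasCompactSupport hLs.mul_left
  -- (1) the periodic part pairs to zero with `Δ_v w`
  have hper : ∀ m : ((Finset.univ : Finset ι) : Set ι) → ℤ,
      ∀ᵐ x ∂μ, ρ (latticeVecOn Φ Finset.univ m + x) = ρ x := fun m => by
    have hZ : ∀ᵐ x ∂μ, x ∉ ϑ ⁻¹' {0} :=
      measure_eq_zero_iff_ae_notMem.1 (measure_preimage_zero_eq_zero_of_isAddHaarMeasure μ hϑd hϑ0)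
    filter_upwards [hZ] with x hx
    rw [latticeVecOn_apply, hρ]
    simp only [hB]
    exact log_norm_sub_ahExponent_periodic Φ hη hχ hϑ (extendOn Finset.univ m) hx
  have key1 : ∫ x, ρ x * L x ∂μ = 0 := by
    have h1 := integral_mul_fderiv_fderiv_weight_eq_zero Φ μ hρi hper v v
    have h2 := integral_mul_fderiv_fderiv_weight_eq_zero Φ μ hρi hper (I • v) (I • v)
    have hi1 : Integrable (fun x => ρ x * fderiv ℝ (fderiv ℝ w) x v v) μ := by
      simpa only [smul_eq_mul] using hρi.integrable_smul_right_of_hasCompactSupport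
        (continuous_fderiv_fderiv_weight_univ Φ v v) (hasCompactSupport_fderiv_fderiv_weight_univ Φ v v)
    have hi2 : Integrable (fun x => ρ x * fderiv ℝ (fderiv ℝ w) x (I • v) (I • v)) μ := by
      simpa only [smul_eq_mul] using hρi.integrable_smul_right_of_hasCompactSupport
        (continuous_fderiv_fderiv_weight_univ Φ (I • v) (I • v))
        (hasCompactSupport_fderiv_fderiv_weight_univ Φ (I • v) (I • v))
    have hsplit : (fun x => ρ x * L x) = fun x => ρ x * fderiv ℝ (fderiv ℝ w) x v v +
        ρ x * fderiv ℝ (fderiv ℝ w) x (I • v) (I • v) := funext fun x => by simp only [hL]; ring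
    rw [hsplit, integral_add hi1 hi2, h1, h2, add_zero]
  -- (2) the quadratic part: `∫ q Δ_v w = ∫ (Δ_v q) w = 4 H(v,v) ∫ w`
  have key2 : ∫ x, B x x * L x ∂μ = 4 * η ![I • v, v] * μ.real (periodBox Φ 0) := by
    have h : ∫ x, B x x * L x ∂μ =
        ∫ x, (fderiv ℝ (fderiv ℝ fun z => B z z) x v v +
          fderiv ℝ (fderiv ℝ fun z => B z z) x (I • v) (I • v)) * w x ∂μ :=
      integral_mul_lineLaplacian_eq_integral_lineLaplacian_mul hqc hwc hws hv
    rw [h]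
    simp_rw [lineLaplacian_ahExponent hB]
    rw [integral_const_mul, integral_weight Φ μ, slab_univ_eq_periodBox]
  -- assemble: `log ‖ϑ‖ = ρ + (π/2) q`
  calc ∫ x, Real.log ‖ϑ x‖ *
          (fderiv ℝ (fderiv ℝ w) x v v + fderiv ℝ (fderiv ℝ w) x (I • v) (I • v)) ∂μ
      = ∫ x, (ρ x * L x + π / 2 * (B x x * L x)) ∂μ :=
        integral_congr_ae (ae_of_all _ fun x => by simp only [hρ, hL]; ring)
    _ = ∫ x, ρ x * L x ∂μ + π / 2 * ∫ x, B x x * L x ∂μ := by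
        rw [integral_add hρL (hqL.const_mul (π / 2)), integral_const_mul]
    _ = 2 * π * η ![I • v, v] * μ.real (periodBox Φ 0) := by rw [key1, key2]; ring

end RightHandSide

/-! ### §3 `[Y]_e(v, iv) = H(v, v)` for the hypersurface of a minimal theta function -/

section Pair

variable {ι : Type*} [Fintype ι] [DecidableEq ι] {E : Type u} [NormedAddCommGroup E]
  [InnerProductSpace ℂ E] [FiniteDimensional ℂ E] [MeasurableSpace E] [BorelSpace E]
  (Φ : (ι → ℝ) ≃L[ℝ] E) {n d : ℕ} (e : Fin n ≃ ι) (h : 2 * d + 2 = n)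
  {η : E [⋀^Fin 2]→L[ℝ] ℝ} {χ : (ι → ℤ) → ℂ}

omit [DecidableEq ι] [MeasurableSpace E] [BorelSpace E] in
include Φ e h in
/-- `dim_ℂ E = d + 1` when `rk Λ = 2d + 2`. [cite: Lange2023AbelianVarietiesComplex, §1.1.4 Prop. 1.1.20] -/
theorem finrank_eq_succ_of_rank : finrank ℂ E = d + 1 := by
  have h1 : finrank ℝ E = n := by
    rw [← Φ.toLinearEquiv.finrank_eq, Module.finrank_fintype_fun_eq_card, ← Fintype.card_congr e,
      Fintype.card_fin]
  have h2 := Module.finrank_mul_finrank ℝ ℂ E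
  rw [Complex.finrank_real_complex, h1] at h2
  omega

/-- **`[Y]_e(v, iv) = H(v, v)` for unit `v`.** Let `Y ⊂ X = E/Λ` be closed analytic of pure dimension
`d = dim X - 1`, `e` positively oriented, and `ϑ ≠ 0` a classical theta function of type `(H, χ)` with
`{ϑ = 0} = π⁻¹Y` which is a minimal defining function of `π⁻¹Y` (such `ϑ` exists for every `Y`,
`exists_thetaFunction_of_hasPureCodim_one`). Then for every unit vector `v`,
`[Y]_e(v, iv) = E(iv, v) = H(v, v)`: the left side is the weighted period
`∫ vol(v, iv, ξ) w d(𝓗 ⌞ reg π⁻¹Y)` (p07 §3), which by the Poincaré–Lelong formula in Crofton–Jensen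
form (FILE 2, with `df ≠ 0` on `reg π⁻¹Y` from minimality, `SCV.IsMinimalAt.fderiv_ne_zero`) equals
`vol(v, iv, e_W) · (1/2π) ∫ log ‖ϑ‖ Δ_v w = vol(v, iv, e_W) · H(v, v) · covol = H(v, v)` (§2 and the
normalisation `volumeForm_apply_mul_measureReal_periodBox_eq_one`).
[cite: GriffithsHarrisPrinciples1978, Ch. 1 §1 (p. 141)] [cite: Chirka1989, §16.3 Thm. 1 (proof, p. 216)] -/
theorem analyticCycleClass_apply_pair_eq_of_thetaFunction_of_norm_eq_one
    {Y : Set (ComplexTorus Φ)} (hY : HasPureDim 𝓘(ℂ, E) Y d) (he : orientationSign Φ e = 1)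
    (hη : IsNSForm Φ η) (hχ : IsSemicharacter Φ η χ) {ϑ : E → ℂ}
    (hϑ : ϑ ∈ thetaFunctions Φ (canonicalFactor Φ η χ)) (hϑ0 : ϑ ≠ 0)
    (hzero : {w | ϑ w = 0} = cover Φ ⁻¹' Y) (hmin : SCV.IsMinimalDefiningOn (cover Φ ⁻¹' Y) univ ϑ)
    {v : E} (hv : ‖v‖ = 1) :
    analyticCycleClass Φ e h hY ![v, I • v] = ((η ![I • v, v] : ℝ) : ℂ) := by
  letI iE : InnerProductSpace ℝ E := InnerProductSpace.complexToReal
  have hdim : finrank ℂ E = d + 1 := finrank_eq_succ_of_rank Φ e h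
  set T := analyticChain Φ hY with hT
  set μ := (μHE[finrank ℝ E] : Measure E) with hμ
  set w := weight Φ (Finset.univ : Finset ι) with hw
  set H : ℝ := η ![I • v, v] with hH
  have h2n : 2 + 2 * d = n := by omega
  set θ : E [⋀^Fin (2 + 2 * d)]→L[ℝ] ℝ := reForm (volumeForm Φ ((finCongr h2n).trans e)) with hθ
  -- (i) the left-hand side is the weighted period (p07 §3)
  have hlhs : (analyticCycleClass Φ e h hY ![v, I • v]).re =
      ∫ x in T.carrier, θ (Fin.append ![v, I • v] (T.orientationFrame x)) * w x
        ∂(μHE[2 * d] : Measure E) := by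
    have h1 := re_orientationSign_mul_analyticCycleClass_apply_eq_integral_mul_weight Φ e h hY ![v, I • v]
    rw [he, Int.cast_one, one_mul] at h1
    exact h1
  -- the class takes a real value on the pair
  have him : (analyticCycleClass Φ e h hY ![v, I • v]).im = 0 := by
    have h1 := orientationSign_mul_analyticCycleClass_apply_eq_integral_mul_weight Φ e h hY ![v, I • v]
    rw [he, Int.cast_one, one_mul] at h1
    rw [h1, ofReal_im]
  -- (ii) the data of the Poincaré–Lelong formula (FILE 2)
  have hϑd : Differentiable ℂ ϑ := (mem_thetaFunctions_iff.1 hϑ).1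
  have hϑ0' : ∃ z, ϑ z ≠ 0 := by
    obtain ⟨z, hz⟩ := Function.ne_iff.1 hϑ0
    exact ⟨z, hz⟩
  have hv0 : v ≠ 0 := fun h0 => by rw [h0, norm_zero] at hv; exact zero_ne_one hv
  let bW : OrthonormalBasis (Fin d) ℂ (ℂ ∙ v)ᗮ :=
    (stdOrthonormalBasis ℂ _).reindex (finCongr (finrank_orthogonal_span_singleton_eq hdim hv0))
  -- the support `|T| = π⁻¹Y` in `E`, and the carrier inside it
  have hsupp : ((↑) : (⊤ : Opens E) → E) '' T.support = cover Φ ⁻¹' Y := by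
    rw [hT, analyticChain, support_ofSet]
    ext x
    constructor
    · rintro ⟨y, hy, rfl⟩; exact hy
    · intro hx; exact ⟨⟨x, trivial⟩, hx, rfl⟩
  have hTf : T.carrier ⊆ ϑ ⁻¹' {0} := fun x hx => by
    have hx' : x ∈ cover Φ ⁻¹' Y := hsupp ▸ T.carrier_subset_image_support hx
    have : x ∈ {w | ϑ w = 0} := hzero ▸ hx'
    exact this
  have hfg : ∀ x, ϑ x = 0 → w x ≠ 0 → x ∈ ((↑) : (⊤ : Opens E) → E) '' T.support := fun x hx _ => by
    rw [hsupp, ← hzero]; exact hx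
  -- `dϑ ≠ 0` on the carrier: the points of the carrier are regular of codimension one, and `ϑ` is minimal
  have hdf : ∀ x ∈ T.carrier, fderiv ℂ ϑ x ≠ 0 := fun x hx => by
    obtain ⟨-, hreg⟩ := T.isRegPt_of_mem_carrier hx
    rw [hsupp, hdim, show d + 1 - d = 1 by omega] at hreg
    have hxY : x ∈ cover Φ ⁻¹' Y := hsupp ▸ T.carrier_subset_image_support hx
    exact (hmin.isMinimalAt (mem_univ x)).fderiv_ne_zero hxY hreg
  have hPL := T.two_pi_mul_setIntegral_carrier_eq_of_exists_ne_zero hdim hϑd hϑ0' hTf hdf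
    (contDiff_weight Φ Finset.univ) (hasCompactSupport_weight_univ Φ) (weight_nonneg Φ Finset.univ)
    (fun _ _ => trivial) hfg hv bW θ
  -- (iii) the constant `c = vol(v, iv, e_W)` and `c · covol = 1`
  set c : ℝ := θ (Fin.append ![v, I • v] (complexFrame fun j => (bW j : E))) with hc
  have hu := orthonormal_append_orthogonal hv bW
  have hframe : Fin.append ![v, I • v] (complexFrame fun j => (bW j : E)) =
      complexFrame (Fin.append (fun _ : Fin 1 => v) fun j => (bW j : E)) ∘
        Fin.cast (by ring : 2 * 1 + 2 * d = 2 * (1 + d)) := by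
    rw [← append_complexFrame_complexFrame, complexFrame_const_one]
  have hN : finrank ℝ E = 2 + 2 * d := by rw [finrank_real_of_complex, hdim]; ring
  have hccovol : c * μ.real (periodBox Φ 0) = 1 := by
    rw [hc, hθ, reForm_apply]
    refine volumeForm_apply_mul_measureReal_periodBox_eq_one Φ ((finCongr h2n).trans e) hN ?_ ?_ 0
    · rw [hframe]
      exact (orthonormal_complexFrame hu).comp _ (Fin.cast_injective _)
    · rw [hframe, isPosOriented_comp_cast_iff]
      haveI : Nonempty (Fin (1 + d)) := ⟨⟨0, by omega⟩⟩
      have hcard : Fintype.card (Fin (1 + d)) = finrank ℂ E := by rw [Fintype.card_fin, hdim]; omega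
      have hb := isPosOriented_interleave_basis (basisOfOrthonormalOfCardEqFinrank hu hcard)
      rw [coe_basisOfOrthonormalOfCardEqFinrank] at hb
      rwa [complexFrame_eq_sumElim_finTwoMulEquivSum]
  have hcovol_pos : 0 < μ.real (periodBox Φ 0) := by
    rcases lt_trichotomy 0 (μ.real (periodBox Φ 0)) with h0 | h0 | h0
    · exact h0
    · rw [← h0, mul_zero] at hccovol; exact absurd hccovol zero_ne_one
    · exact absurd h0 (not_lt.2 measureReal_nonneg)
  have hc0 : 0 < c := by
    by_contra hle
    rw [not_lt] at hle
    have := mul_nonpos_of_nonpos_of_nonneg hle hcovol_pos.le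
    linarith
  -- (iv) the right-hand side (§2)
  have hrhs := integral_log_norm_theta_mul_lineLaplacian_weight Φ hη hχ hϑ hϑ0' hv
  -- assemble
  have hre : (analyticCycleClass Φ e h hY ![v, I • v]).re = H := by
    have h1 := hPL hc0.le
    rw [hrhs, ← hlhs] at h1
    -- `2π · [Y](v,iv) = c · (2π H covol) = 2π H · (c · covol) = 2π H`
    have h2 : 2 * π * (analyticCycleClass Φ e h hY ![v, I • v]).re = 2 * π * H := by
      rw [h1, show c * (2 * π * η ![I • v, v] * μ.real (periodBox Φ 0)) =
        2 * π * H * (c * μ.real (periodBox Φ 0)) by rw [hH]; ring, hccovol, mul_one]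
    exact mul_left_cancel₀ (by positivity : (2 : ℝ) * π ≠ 0) h2
  exact Complex.ext (by rw [ofReal_re, hre]) (by rw [ofReal_im, him])

omit [Fintype ι] [DecidableEq ι] [FiniteDimensional ℂ E] [MeasurableSpace E] [BorelSpace E] in
/-- Quadratic scaling of a `2`-form on the pair `(x, ix)`: `γ(cx, i(cx)) = c² γ(x, ix)`.
[cite: Lange2023AbelianVarietiesComplex, §2.1.2 Lemma 2.1.7] -/
theorem apply_pair_I_smul_real_smul {F : Type*} [NormedAddCommGroup F] [NormedSpace ℝ F]
    (γ : E [⋀^Fin 2]→L[ℝ] F) (c : ℝ) (x : E) :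
    γ ![c • x, I • (c • x)] = (c ^ 2) • γ ![x, I • x] := by
  have hx : (![c • x, I • (c • x)] : Fin 2 → E) = fun i => c • (![x, I • x] : Fin 2 → E) i := by
    funext i
    fin_cases i
    · rfl
    · simp [smul_comm c I x]
  rw [hx, γ.map_smul_univ, Fin.prod_univ_two, pow_two]

/-- **`[Y]_e(v, iv) = H(v, v)` for every `v`** (homogeneity from the unit case).
[cite: GriffithsHarrisPrinciples1978, Ch. 1 §1 (p. 141)] [cite: Chirka1989, §16.3 Thm. 1] -/
theorem analyticCycleClass_apply_pair_eq_of_thetaFunction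
    {Y : Set (ComplexTorus Φ)} (hY : HasPureDim 𝓘(ℂ, E) Y d) (he : orientationSign Φ e = 1)
    (hη : IsNSForm Φ η) (hχ : IsSemicharacter Φ η χ) {ϑ : E → ℂ}
    (hϑ : ϑ ∈ thetaFunctions Φ (canonicalFactor Φ η χ)) (hϑ0 : ϑ ≠ 0)
    (hzero : {w | ϑ w = 0} = cover Φ ⁻¹' Y) (hmin : SCV.IsMinimalDefiningOn (cover Φ ⁻¹' Y) univ ϑ)
    (v : E) :
    analyticCycleClass Φ e h hY ![v, I • v] = ((η ![I • v, v] : ℝ) : ℂ) := by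
  set γ := analyticCycleClass Φ e h hY with hγ
  by_cases hv0 : v = 0
  · subst hv0
    have h1 : γ ![(0 : E), I • (0 : E)] = 0 := γ.map_coord_zero 0 rfl
    have h2 : η ![I • (0 : E), 0] = 0 := η.map_coord_zero 1 rfl
    rw [h1, h2, ofReal_zero]
  · obtain ⟨c, u, hc0, hu1, hvu⟩ : ∃ (c : ℝ) (u : E), c ≠ 0 ∧ ‖u‖ = 1 ∧ v = c • u :=
      ⟨‖v‖, ‖v‖⁻¹ • v, norm_ne_zero_iff.2 hv0,
        by rw [norm_smul, norm_inv, norm_norm, inv_mul_cancel₀ (norm_ne_zero_iff.2 hv0)],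
        by rw [smul_inv_smul₀ (norm_ne_zero_iff.2 hv0)]⟩
    have hunit := analyticCycleClass_apply_pair_eq_of_thetaFunction_of_norm_eq_one Φ e h hY he hη hχ
      hϑ hϑ0 hzero hmin hu1
    subst hvu
    have hR : η ![I • (c • u), c • u] = c ^ 2 * η ![I • u, u] := by
      rw [twoForm_swap η (I • (c • u)) (c • u), apply_pair_I_smul_real_smul η c u, smul_eq_mul,
        twoForm_swap η u (I • u)]
      ring
    rw [apply_pair_I_smul_real_smul γ, hunit, hR, Complex.real_smul]
    push_cast
    ring

end Pair

/-! ### §4 `[Y] = ofRealForm (-E) = c₁(L(H, χ)) = c₁(𝒪_X(Y))` -/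

section Class

variable {ι : Type*} [Fintype ι] [DecidableEq ι] {E : Type u} [NormedAddCommGroup E]
  [InnerProductSpace ℂ E] [FiniteDimensional ℂ E] [MeasurableSpace E] [BorelSpace E]
  (Φ : (ι → ℝ) ≃L[ℝ] E) {n d : ℕ} (e : Fin n ≃ ι) (h : 2 * d + 2 = n)

omit [Fintype ι] [DecidableEq ι] [FiniteDimensional ℂ E] [MeasurableSpace E] [BorelSpace E] in
/-- **Two `I`-invariant real `2`-forms with the same Hermitian quadratic form coincide**: if
`η(iu, iv) = η(u, v)`, `η'(iu, iv) = η'(u, v)` and `η(iv, v) = η'(iv, v)` for all `v`, then `η = η'`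
(the symmetric form `Re H(v, w) = η(iv, w)` is recovered from `H(v, v)` by polarization, and
`η(v, w) = Re H(-iv, w)`). [cite: Lange2023AbelianVarietiesComplex, §1.2.2 Lemma 1.2.10 and §2.1.2 Lemma 2.1.7] -/
theorem twoForm_eq_of_forall_apply_I_smul_self {η η' : E [⋀^Fin 2]→L[ℝ] ℝ}
    (h11 : ∀ u v : E, η ![I • u, I • v] = η ![u, v])
    (h11' : ∀ u v : E, η' ![I • u, I • v] = η' ![u, v])
    (hdiag : ∀ v : E, η ![I • v, v] = η' ![I • v, v]) : η = η' := by
  -- polarization of the symmetric forms `g(v, w) = η(iv, w)`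
  have hpol : ∀ v w : E, η ![I • v, w] = η' ![I • v, w] := fun v w => by
    have h1 := ahExponent_add h11 v w
    have h2 := ahExponent_add h11' v w
    have h3 := hdiag (v + w)
    rw [h1, h2, hdiag v, hdiag w] at h3
    linarith
  ext u
  have hu : u = ![u 0, u 1] := by
    funext i; fin_cases i <;> rfl
  rw [hu]
  have := hpol (-(I • u 0)) (u 1)
  rwa [smul_neg, smul_smul, Complex.I_mul_I, neg_one_smul, neg_neg] at this

/-- **The Poincaré–Lelong formula on a complex torus, for the hypersurface of a minimal theta
function: `[Y]_e = ofRealForm (-E) = c₁(L(H, χ))`.** In the situation of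
`analyticCycleClass_apply_pair_eq_of_thetaFunction` (`Y` of pure dimension `dim X - 1`, `e` positively
oriented, `ϑ ≠ 0` of type `(H, χ)` minimal for `π⁻¹Y = {ϑ = 0}`), the analytic cycle class of `Y` IS
the first Chern class of `L(H, χ)` in the tree's normalisation (`ComplexTorusAppellHumbertChernClass`:
`c₁(L(H, χ)) = [constForm (-ofRealForm E)]`, `E = Im H`). [cite: GriffithsHarrisPrinciples1978, Ch. 1 §1 (p. 141)]
[cite: Chirka1989, §16.3 Thm. 1] [cite: VoisinHodgeI2002, §11.1.2 Thm. 11.33] -/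
theorem analyticCycleClass_eq_ofRealForm_neg_of_thetaFunction
    {Y : Set (ComplexTorus Φ)} (hY : HasPureDim 𝓘(ℂ, E) Y d) (he : orientationSign Φ e = 1)
    {η : E [⋀^Fin 2]→L[ℝ] ℝ} {χ : (ι → ℤ) → ℂ} (hη : IsNSForm Φ η) (hχ : IsSemicharacter Φ η χ)
    {ϑ : E → ℂ} (hϑ : ϑ ∈ thetaFunctions Φ (canonicalFactor Φ η χ)) (hϑ0 : ϑ ≠ 0)
    (hzero : {w | ϑ w = 0} = cover Φ ⁻¹' Y) (hmin : SCV.IsMinimalDefiningOn (cover Φ ⁻¹' Y) univ ϑ) :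
    analyticCycleClass Φ e h hY = ofRealForm (-η) := by
  -- `[Y]_e = ofRealForm (-η₀)` with `η₀` of type `(1,1)` (Voisin Prop. 11.20, tree leaf (lix))
  have h' : 2 * d + 2 * 1 = n := by omega
  have hcast : analyticCycleClass Φ e h hY = analyticCycleClass Φ e h' hY := rfl
  obtain ⟨η₀, -, hcl, h11₀, -⟩ := exists_semipos_analyticCycleClass_eq_of_hypersurface Φ e h' hY he
  rw [hcast, hcl]
  congr 2
  refine twoForm_eq_of_forall_apply_I_smul_self h11₀ hη.type_one_one fun v => ?_
  -- compare on the pairs `(v, iv)`: `-η₀(v, iv) = [Y](v, iv) = η(iv, v)`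
  have h1 := analyticCycleClass_apply_pair_eq_of_thetaFunction Φ e h' hY he hη hχ hϑ hϑ0 hzero hmin v
  rw [hcl, ofRealForm_apply, ofReal_inj, ContinuousAlternatingMap.neg_apply, twoForm_swap η₀ v (I • v),
    neg_neg] at h1
  exact h1

/-- **`[Y] = c₁(𝒪_X(Y))` for EVERY analytic hypersurface of a complex torus.** For `Y ⊂ X = E/Λ` closed
analytic of pure dimension `d = dim X - 1` (singular points allowed) and a positively oriented
enumeration `e` of the lattice basis, there are an effective Cartier divisor `D` with `|D| = Y`, an
Appell–Humbert datum `(H, χ)` with `𝒪_X(Y) = 𝒪_X(D) ≅ L(H, χ)` and a classical theta function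
`ϑ ≠ 0` of type `(H, χ)`, minimal for `π⁻¹Y = {ϑ = 0}`, such that

  `analyticCycleClass Φ e h hY = ofRealForm (-Im H)` — i.e. `[Y] = c₁(L(H, χ)) = c₁(𝒪_X(Y))`

in `H²(X, ℂ) = Alt²_ℝ(E; ℂ)` (Griffiths–Harris: "the first Chern class of the line bundle `[D]` is the
fundamental class of `D`"; the Néron–Severi form `η` of the tree's
`exists_mem_neronSeveriGroup_analyticCycleClass_eq_of_hypersurface` IS `Im H` of `𝒪_X(Y)`).
[cite: GriffithsHarrisPrinciples1978, Ch. 1 §1 (p. 141)] [cite: Chirka1989, §16.3 Thm. 1 (pp. 214–216)]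
[cite: Lang1982AbelianFunctions, Ch. X §1 Thm. 1.1] [cite: VoisinHodgeI2002, §11.1.2 Thm. 11.33] -/
theorem analyticCycleClass_eq_chernClass_of_hasPureDim {Y : Set (ComplexTorus Φ)}
    (hY : HasPureDim 𝓘(ℂ, E) Y d) (he : orientationSign Φ e = 1) :
    ∃ (D : EffectiveCartierDivisor (Option ↥Y) E (ComplexTorus Φ)) (η : E [⋀^Fin 2]→L[ℝ] ℝ)
      (χ : (ι → ℤ) → ℂ) (hη : IsNSForm Φ η) (hχ : IsSemicharacter Φ η χ) (ϑ : E → ℂ),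
      D.support = Y ∧
      (D.lineBundle.tensor (factorLineBundle (isFactor_canonicalFactor Φ hη hχ).inv)).IsTrivialOn univ ∧
      ϑ ∈ thetaFunctions Φ (canonicalFactor Φ η χ) ∧ ϑ ≠ 0 ∧ {w | ϑ w = 0} = cover Φ ⁻¹' Y ∧
      SCV.IsMinimalDefiningOn (cover Φ ⁻¹' Y) univ ϑ ∧
      analyticCycleClass Φ e h hY = ofRealForm (-η) := by
  have hdim : finrank ℂ E = d + 1 := finrank_eq_succ_of_rank Φ e h
  have hYc : HasPureCodim 𝓘(ℂ, E) Y 1 := by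
    have := hY.hasPureCodim
    rwa [hdim, show d + 1 - d = 1 by omega] at this
  obtain ⟨D, η, χ, hη, hχ, ϑ, hsupp, htriv, hϑ, hϑ0, hzero, hmin⟩ :=
    exists_thetaFunction_of_hasPureCodim_one (Φ := Φ) hYc
  exact ⟨D, η, χ, hη, hχ, ϑ, hsupp, htriv, hϑ, hϑ0, hzero, hmin,
    analyticCycleClass_eq_ofRealForm_neg_of_thetaFunction Φ e h hY he hη hχ hϑ hϑ0 hzero hmin⟩

/-- **The Néron–Severi form of a hypersurface is `Im H` of its line bundle, hence `H ≥ 0` is the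
Hermitian form of `𝒪_X(Y)`**: packaged form of `[Y] = ofRealForm (-η)` with `η ∈ NS(X)` the
Appell–Humbert form of `𝒪_X(Y)`. [cite: GriffithsHarrisPrinciples1978, Ch. 1 §1 (p. 141)]
[cite: Lange2023AbelianVarietiesComplex, §2.1.1 (p. 76)] -/
theorem exists_isNSForm_analyticCycleClass_eq_of_hasPureDim {Y : Set (ComplexTorus Φ)}
    (hY : HasPureDim 𝓘(ℂ, E) Y d) (he : orientationSign Φ e = 1) :
    ∃ (η : E [⋀^Fin 2]→L[ℝ] ℝ) (χ : (ι → ℤ) → ℂ) (ϑ : E → ℂ), IsNSForm Φ η ∧ IsSemicharacter Φ η χ ∧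
      ϑ ∈ thetaFunctions Φ (canonicalFactor Φ η χ) ∧ ϑ ≠ 0 ∧ {w | ϑ w = 0} = cover Φ ⁻¹' Y ∧
      analyticCycleClass Φ e h hY = ofRealForm (-η) := by
  obtain ⟨-, η, χ, hη, hχ, ϑ, -, -, hϑ, hϑ0, hzero, -, hcl⟩ :=
    analyticCycleClass_eq_chernClass_of_hasPureDim Φ e h hY he
  exact ⟨η, χ, ϑ, hη, hχ, hϑ, hϑ0, hzero, hcl⟩

end Class

end ComplexTorus

end Literature.Geometry.Kaehler

end
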